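import Literature.Probability.RandomPlanarGeometry.SAWCountMonotoneSharpOdd
import Literature.Probability.RandomPlanarGeometry.SAWCountMonotoneEscape
import HarnessLib

/-!
# Walks trapped at BOTH ends exist at every odd length `n ≥ 6d - 1`: the escape residual is
# nonempty there, in every dimension `d ≥ 2`

Companion of `SAWCountMonotoneEscape.lean` (the escape injection: `cₙ ≤ cₙ₊₁ + #R`,
`R = escapeResidual d n` = doomed end and completely surrounded start ⊇ the walks trapped at both ends)
and of `SAWCountMonotoneSharpOdd.lean` (`oddWitness m k`: trapped end, exactly ONE free start site
`oddLat m 1`, length `6m + 9 + 2k` on `ℤ^{m+2}`).  Visiting that last free site first — `0, v₁, -e₀ + v₁,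
-e₀` instead of `0, -e₀` — gives a walk two steps longer with a trapped end AND a completely surrounded
start:

* `bothTrappedWitness m k` (length `6m + 11 + 2k = 6d - 1 + 2k` on `ℤ^{m+2}`);
* `bothTrappedWitness_mem_escapeResidual` : it lies in `R`;
* `escapeResidual_nonempty_of_odd` : **`R(d, n) ≠ ∅` for every `d ≥ 2` and every odd `n ≥ 6d - 1`**.

So the escape route can prove O'Brien's inequality at an odd length only for `n ≤ 6d - 3`; exhaustive
enumeration (lane «pcv-sawmu» a-p4 g26, kit j306921 / j307755, not used in proofs) gives `R = ∅` on `ℤ²`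
for `n ≤ 10` and on `ℤ³` for `n ≤ 16` and `n = 18`, with `#R(2, 11) = 8`, `#R(3, 17) = 2736`: the odd
threshold of `R` is exactly `6d - 1` for `d = 2, 3`.

[cite: MadrasSlade1993, §1.1; §7.1 p. 231 (`c_{N+1} ≥ c_N`, O'Brien)] [cite: BDGS2012, §1.3 (`cₙ ≤ cₙ₊₁`, O'Brien 1990)]
-/

noncomputable section

open Literature.Probability.LatticeModels Literature.Probability.Percolation SimpleGraph

namespace Literature.Probability.RandomPlanarGeometry.SAW.Zd

variable {d : ℕ}

/-- Bounded criterion for a COMPLETELY SURROUNDED START: every neighbour `± eₖ` of the origin is some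
`ω i`, `i ≤ n`. [cite: MadrasSlade1993, §1.1] -/
theorem extCount_revWalk_eq_zero_of_forall {ω : ℕ → Site d} {n : ℕ} (hω : ω ∈ saws d n)
    (hstart : ∀ k : Fin d, (∃ i < n + 1, ω i = Pi.single k 1) ∧ (∃ i < n + 1, ω i = -Pi.single k 1)) :
    extCount (revWalk n ω) n = 0 := by
  classical
  obtain ⟨h0, -, -, -⟩ := mem_saws.1 hω
  rw [extCount, Finset.card_eq_zero, Finset.eq_empty_iff_forall_notMem]
  intro y hy
  rw [mem_freeNbrs_revWalk hω, h0] at hy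
  obtain ⟨hadj, hfree⟩ := hy
  obtain ⟨k, hk | hk⟩ := (zdGraph_adj_iff _ _).1 hadj
  · rw [zero_add] at hk
    obtain ⟨i, hi, hiy⟩ := (hstart k).1
    exact hfree i (by omega) (hiy.trans hk.symm)
  · have hk' : ω n - y = -(Pi.single k 1 : Site d) := eq_neg_of_add_eq_zero_left hk.symm
    obtain ⟨i, hi, hiy⟩ := (hstart k).2
    exact hfree i (by omega) (hiy.trans hk'.symm)

variable {m k : ℕ}

/-- The spine coordinate of the origin. [cite: MadrasSlade1993, §1.1] -/
@[simp] theorem spineCoord_zero : spineCoord m (0 : Site (m + 2)) = 0 := rfl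

/-- The lateral functionals vanish at the origin. [cite: MadrasSlade1993, §1.1] -/
@[simp] theorem oddFun_zero (j : ℕ) : oddFun m j (0 : Site (m + 2)) = 0 := by
  unfold oddFun latFun; split_ifs <;> simp

/-! ### The both-trapped witness -/

/-- **The both-trapped witness** on `ℤ^{m+2}`: `0, v₁, -e₀ + v₁`, then the odd witness from its time `1`
on (`-e₀, …, -(k+1)e₀`, back along `v₀`, head, rungs, end `e₀`); length `6m + 11 + 2k`.
[cite: BDGS2012, §1.3] -/
def bothTrappedWitness (m k : ℕ) (t : ℕ) : Site (m + 2) :=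
  if t = 0 then 0 else if t = 1 then oddLat m 1 else if t = 2 then spinePt m (-1) + oddLat m 1
  else oddWitness m k (t - 2)

/-- From time `3` on the both-trapped witness is the odd witness shifted by two. [cite: BDGS2012, §1.3] -/
theorem bothTrappedWitness_of_three_le {t : ℕ} (ht : 3 ≤ t) :
    bothTrappedWitness m k t = oddWitness m k (t - 2) := by
  simp [bothTrappedWitness, show t ≠ 0 by omega, show t ≠ 1 by omega, show t ≠ 2 by omega]

/-- The odd witness never visits its free start site `oddLat m 1`. [cite: BDGS2012, §1.3] -/
theorem oddWitness_ne_oddLat_one {t : ℕ} (ht : t ≤ 2 * k + 6 * m + 9) : oddWitness m k t ≠ oddLat m 1 := by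
  intro heq
  have hX := congrArg (spineCoord m) heq
  have hF := congrArg (oddFun m 1) heq
  simp only [spineCoord_oddLat, oddFun_oddLat_self] at hX hF
  rcases oddWitness_zones (m := m) (k := k) (t := t) ht with
      hA | ⟨hB1, hB2⟩ | ⟨s, hs, rfl⟩ | ⟨j, r, hj1, hj2, hr, rfl⟩ | rfl
  · have := oddFun_one_oddWitness_nonpos (m := m) (k := k) (t := t) (by omega); omega
  · have := oddFun_one_oddWitness_nonpos (m := m) (k := k) (t := t) (by omega); omega
  · rw [oddWitness_head hs, spineCoord_oddHead] at hX
    rw [oddWitness_head hs, oddFun_oddHead] at hF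
    have h0 : oddFun m 1 (oddLat m 0) ≤ 0 := oddFun_oddLat_le (by omega) (by omega) (by omega)
    split_ifs at hX hF <;> omega
  · rw [oddWitness_rung hj1 hj2 hr, spineCoord_oddRung] at hX
    rw [oddWitness_rung hj1 hj2 hr, oddFun_oddRung] at hF
    rcases Nat.lt_or_ge j 3 with hj3 | hj3
    · -- rung 2: `oddFun 1` is `1` only at the corner, whose spine coordinate is `1`
      obtain rfl : j = 2 := by omega
      have h2 : oddFun m 1 (oddLat m 2) = 0 := (oddFun_oddLat_pred (m := m) (j := 2) le_rfl hj2).2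
      rw [h2] at hF
      split_ifs at hX hF <;> simp at hX <;> omega
    · have ha : oddFun m 1 (oddLat m j) ≤ 0 := oddFun_oddLat_le hj2 (by omega) (by omega)
      have hb : oddFun m 1 (oddLat m (j - 1)) ≤ 0 := oddFun_oddLat_le (by omega) (by omega) (by omega)
      split_ifs at hF <;> omega
  · rw [oddWitness_of_ge le_rfl, oddFun_spinePt] at hF; omega

/-- The odd witness never visits `-e₀ + oddLat m 1`. [cite: BDGS2012, §1.3] -/
theorem oddWitness_ne_neg_add_oddLat_one {t : ℕ} (ht : t ≤ 2 * k + 6 * m + 9) :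
    oddWitness m k t ≠ spinePt m (-1) + oddLat m 1 := by
  intro heq
  have hX := congrArg (spineCoord m) heq
  have hF := congrArg (oddFun m 1) heq
  simp only [spineCoord_add, spineCoord_spinePt, spineCoord_oddLat, oddFun_add, oddFun_spinePt,
    oddFun_oddLat_self] at hX hF
  rcases oddWitness_zones (m := m) (k := k) (t := t) ht with
      hA | ⟨hB1, hB2⟩ | ⟨s, hs, rfl⟩ | ⟨j, r, hj1, hj2, hr, rfl⟩ | rfl
  · have := oddFun_one_oddWitness_nonpos (m := m) (k := k) (t := t) (by omega); omega
  · have := oddFun_one_oddWitness_nonpos (m := m) (k := k) (t := t) (by omega); omega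
  · rw [oddWitness_head hs, spineCoord_oddHead] at hX
    split_ifs at hX <;> omega
  · rw [oddWitness_rung hj1 hj2 hr, spineCoord_oddRung] at hX
    split_ifs at hX <;> omega
  · rw [oddWitness_of_ge le_rfl, spineCoord_spinePt] at hX; omega

/-- **The both-trapped witness never revisits a site on `[0, 6m + 11 + 2k]`.** [cite: BDGS2012, §1.3] -/
theorem bothTrappedWitness_ne {t t' : ℕ} (htt : t' < t) (ht : t ≤ 2 * k + 6 * m + 11) :
    bothTrappedWitness m k t' ≠ bothTrappedWitness m k t := by
  intro heq
  have h1pos : (oddFun m 1 (oddLat m 1) : ℤ) = 1 := oddFun_oddLat_self 1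
  rcases Nat.lt_or_ge t 3 with h3 | h3
  · -- both among the first three sites `0, v₁, -e₀ + v₁`
    have hX := congrArg (spineCoord m) heq
    have hF := congrArg (oddFun m 1) heq
    interval_cases t <;> interval_cases t' <;>
      simp [bothTrappedWitness] at hX hF
  rw [bothTrappedWitness_of_three_le h3] at heq
  rcases Nat.lt_or_ge t' 3 with h3' | h3'
  · interval_cases t'
    · -- `0` is the odd witness only at its time `0`
      have : bothTrappedWitness m k 0 = oddWitness m k 0 := by
        simp [bothTrappedWitness, oddWitness_of_le_succ (Nat.zero_le _)]
      rw [this] at heq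
      exact oddWitness_ne (m := m) (k := k) (t := t - 2) (t' := 0) (by omega) (by omega) heq
    · have : bothTrappedWitness m k 1 = oddLat m 1 := by simp [bothTrappedWitness]
      rw [this] at heq
      exact oddWitness_ne_oddLat_one (by omega) heq.symm
    · have : bothTrappedWitness m k 2 = spinePt m (-1) + oddLat m 1 := by simp [bothTrappedWitness]
      rw [this] at heq
      exact oddWitness_ne_neg_add_oddLat_one (by omega) heq.symm
  · rw [bothTrappedWitness_of_three_le h3'] at heq
    exact oddWitness_ne (m := m) (k := k) (by omega) (by omega) heq

/-- **Consecutive sites of the both-trapped witness are lattice neighbours.** [cite: BDGS2012, §1.3] -/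
theorem bothTrappedWitness_adj {i : ℕ} (hi : i < 2 * k + 6 * m + 11) :
    (zdGraph (m + 2)).Adj (bothTrappedWitness m k i) (bothTrappedWitness m k (i + 1)) := by
  rcases Nat.lt_or_ge i 3 with h | h
  · interval_cases i
    · rw [show bothTrappedWitness m k 0 = 0 by simp [bothTrappedWitness],
        show bothTrappedWitness m k 1 = 0 + oddLat m 1 by simp [bothTrappedWitness]]
      exact adj_add_latVec _ _
    · rw [show bothTrappedWitness m k 1 = oddLat m 1 by simp [bothTrappedWitness],
        show bothTrappedWitness m k 2 = spinePt m (-1) + oddLat m 1 by simp [bothTrappedWitness]]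
      have h := adj_add_spinePt_one' (spinePt m (-1) + oddLat m 1)
      rwa [add_right_comm (spinePt m (-1)) (oddLat m 1) (spinePt m 1), spinePt_add,
        show (-1 : ℤ) + 1 = 0 by norm_num, spinePt_zero, zero_add] at h
    · rw [show bothTrappedWitness m k 2 = spinePt m (-1) + oddLat m 1 by simp [bothTrappedWitness],
        bothTrappedWitness_of_three_le le_rfl, show 3 - 2 = 1 by rfl, oddWitness_of_le_succ (by omega),
        show ((1 : ℕ) : ℤ) = 1 by rfl]
      exact adj_add_latVec' _ _
  · rw [bothTrappedWitness_of_three_le h, bothTrappedWitness_of_three_le (by omega),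
      show i + 1 - 2 = (i - 2) + 1 by omega]
    exact oddWitness_adj (by omega)

/-- **The both-trapped witness lies in the escape residual**: trapped end (hence doomed) and
completely surrounded start. [cite: BDGS2012, §1.3] -/
theorem bothTrappedWitness_mem_escapeResidual (m k : ℕ) :
    bothTrappedWitness m k ∈ escapeResidual (m + 2) (2 * k + 6 * m + 11) := by
  set n := 2 * k + 6 * m + 11 with hn
  have hend : ∀ t, n ≤ t → bothTrappedWitness m k t = spinePt m 1 := fun t ht => by
    rw [bothTrappedWitness_of_three_le (by omega), oddWitness_of_ge (by omega)]
  have hsaw : bothTrappedWitness m k ∈ saws (m + 2) n := by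
    refine mem_saws_of_forall (by simp [bothTrappedWitness]) (fun i hi => by rw [hend i hi, hend n le_rfl])
      (fun i hi => bothTrappedWitness_adj hi) ?_
    intro i hi j hj hij
    rcases lt_trichotomy i j with h | h | h
    · exact absurd hij (bothTrappedWitness_ne h (by omega))
    · exact h
    · exact absurd hij.symm (bothTrappedWitness_ne h (by omega))
  -- the sites of the odd witness appear two steps later
  have shift : ∀ s, s < 2 * k + 6 * m + 9 + 1 → ∃ i < n + 1, bothTrappedWitness m k i = oddWitness m k s := by
    intro s hs
    rcases Nat.eq_zero_or_pos s with rfl | hs0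
    · exact ⟨0, by omega, by simp [bothTrappedWitness, oddWitness_of_le_succ (Nat.zero_le _)]⟩
    · exact ⟨s + 2, by omega, by rw [bothTrappedWitness_of_three_le (by omega), Nat.add_sub_cancel]⟩
  refine bothTrapped_subset_escapeResidual (m + 2) n (Finset.mem_filter.2 ⟨hsaw, ?_, ?_⟩)
  · -- trapped end: the cage of `e₀` is the odd witness's
    refine extCount_eq_zero_of_forall fun a => ?_
    rw [hend n le_rfl]
    rcases single_eq_oddLat (m := m) a with ⟨-, ha⟩ | ⟨ha1, ha, ha'⟩
    · rw [ha, spinePt_add, sub_self]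
      obtain ⟨i, hi, he⟩ := shift (2 * k + 3 + 3) (by omega)
      refine ⟨⟨i, hi, ?_⟩, ⟨0, by omega, by simp [bothTrappedWitness]⟩⟩
      rw [he, oddWitness_head (by omega)]; simp [oddHead]
    · rw [sub_eq_add_neg, ha', ha]
      obtain ⟨s₁, hs₁, e₁⟩ := exists_oddWitness_eq_spine_add (m := m) (k := k) (j := (a : ℕ) - 1) (by omega)
      obtain ⟨s₂, hs₂, e₂⟩ := exists_oddWitness_eq_spine_add (m := m) (k := k) (j := (a : ℕ) + m) (by omega)
      obtain ⟨i₁, hi₁, f₁⟩ := shift s₁ hs₁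
      obtain ⟨i₂, hi₂, f₂⟩ := shift s₂ hs₂
      exact ⟨⟨i₁, hi₁, f₁.trans e₁⟩, ⟨i₂, hi₂, f₂.trans e₂⟩⟩
  · -- completely surrounded start
    refine extCount_revWalk_eq_zero_of_forall hsaw fun a => ?_
    rcases single_eq_oddLat (m := m) a with ⟨-, ha⟩ | ⟨ha1, ha, ha'⟩
    · rw [ha]
      refine ⟨⟨n, by omega, hend n le_rfl⟩, ⟨3, by omega, ?_⟩⟩
      rw [bothTrappedWitness_of_three_le le_rfl, show 3 - 2 = 1 by rfl, oddWitness_of_le_succ (by omega)]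
      simp only [spinePt, Nat.cast_one, Pi.single_neg]
    · rw [ha', ha]
      constructor
      · by_cases h1 : (a : ℕ) - 1 = 1
        · exact ⟨1, by omega, by rw [h1]; simp [bothTrappedWitness]⟩
        · obtain ⟨s, hs, e⟩ := exists_oddWitness_eq_lat (m := m) (k := k) (j := (a : ℕ) - 1) (by omega) h1
          obtain ⟨i, hi, f⟩ := shift s hs
          exact ⟨i, hi, f.trans e⟩
      · by_cases h1 : (a : ℕ) + m = 1
        · exact ⟨1, by omega, by rw [h1]; simp [bothTrappedWitness]⟩
        · obtain ⟨s, hs, e⟩ := exists_oddWitness_eq_lat (m := m) (k := k) (j := (a : ℕ) + m) (by omega) h1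
          obtain ⟨i, hi, f⟩ := shift s hs
          exact ⟨i, hi, f.trans e⟩

/-! ### The escape residual is nonempty at every odd `n ≥ 6d - 1` -/

/-- **`R(d, n) ≠ ∅` for every `d ≥ 2` and every odd `n ≥ 6d - 1`**: walks trapped at both ends exist.
[cite: BDGS2012, §1.3] -/
theorem escapeResidual_nonempty_of_odd {d n : ℕ} (hd : 2 ≤ d) (hn : Odd n) (h : 6 * d ≤ n + 1) :
    (escapeResidual d n).Nonempty := by
  obtain ⟨m, rfl⟩ : ∃ m, d = m + 2 := ⟨d - 2, by omega⟩
  obtain ⟨a, ha⟩ := hn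
  obtain ⟨k, rfl⟩ : ∃ k, n = 2 * k + 6 * m + 11 := ⟨(n - (6 * m + 11)) / 2, by omega⟩
  exact ⟨_, bothTrappedWitness_mem_escapeResidual m k⟩

/-- At the odd threshold: **`R(d, 6d - 1) ≠ ∅` for every `d ≥ 2`** (stated with `n + 1 = 6d`): the
escape route cannot prove O'Brien's inequality at odd lengths `n ≥ 6d - 1`. [cite: BDGS2012, §1.3] -/
theorem escapeResidual_nonempty_odd_threshold {d n : ℕ} (hd : 2 ≤ d) (hn : n + 1 = 6 * d) :
    (escapeResidual d n).Nonempty :=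
  escapeResidual_nonempty_of_odd hd ⟨3 * d - 1, by omega⟩ (by omega)

end Literature.Probability.RandomPlanarGeometry.SAW.Zd
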